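import Summits.ValiantsHypothesis.ValiantsHypothesis.Statement
import Literature.Computability.AlgebraicComplexity.ValiantConjectureEquivProofs
import Literature.Computability.AlgebraicComplexity.VNPClosedUnderProjection
import Literature.Computability.AlgebraicComplexity.MS2001Prop44Approximation
import Literature.Barriers.ValiantsHypothesis.GKSS17NaturalProofsPIT
import HarnessLib

/-!
# The bare-residual criterion for restricted-model decompositions of `VP ≠ VNP`

Decomp-valiant workshop, lens 2 «natural-proofs / succinctness axis», generation 23 (census entry V30 /
LESSON 8 of the cell record, put in kernel form).  Unconditional, 0 sorry, one new definition
(`IsProjClosed`); it does NOT prove `VP ≠ VNP` and closes no route item.  It is a LOCATOR: it tells a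
decomposition seat, for a whole family of two-piece nodes at once, when the second piece is empty.

THE NODES.  Fix a class `𝒞 ⊆ VP_k` of bundled families (a "restricted model": `VP_ws = VBP`, `VF`,
bounded depth, families on which a projection-hereditary complexity measure is polynomially small, …) and a
`VNP`-complete bundled family `P` (over `ℂ`: the permanent).  The restricted-model AND-node is

  `S := VP_k ≠ VNP_k`  ⟸  `A_𝒞 := P ∉ 𝒞`  ∧  `B_𝒞 := (VP_k = VNP_k → VP_k ⊆ 𝒞)`,

`A_𝒞` = a lower bound for `P` in the model, `B_𝒞` = "a collapse drags all of `VP` into the model".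
Both pieces are NECESSARY (`VP_ne_VNP_iff_split`: `S ↔ A_𝒞 ∧ B_𝒞` whenever `𝒞 ⊆ VP`).

THE CRITERION (`collapseTo_iff_residual`).  If `𝒞` is closed downward under p-projections among
p-families (`IsProjClosed 𝒞`) then

  `B_𝒞 ↔ (A_𝒞 → S)` :

the collapse piece is EXACTLY the declared residual of the lower-bound piece — it carries no content beyond
"`A_𝒞` suffices" (it is *bare*).  Reason: under `VP = VNP` every `VP` family is a p-family and a
p-projection of the complete family `P` (`vnp_subset_of_complete_mem`), so `VP ⊆ 𝒞 ↔ P ∈ 𝒞 ↔ ¬A_𝒞`.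
No hypothesis on `𝒞` is needed for `B_𝒞 → (A_𝒞 → S)` (`residual_of_collapseTo`); projection-closure is
what makes the converse hold.  Consequently a decomposition on this axis whose collapse piece is to carry
content MUST use a class that is NOT closed under p-projections (fixed-order / any-order ROABP,
set-multilinear and multilinear slices, monotone, uniform, bounded-coefficient models), or a piece of a
different logical shape.  In the dictionary of algebraically natural proofs (`P(f)` = "the measure `μ(f)` is
large", `μ` non-increasing under substitution of variables and constants — rank of partial-derivative /
shifted-partials / coefficient matrices) the class `𝒞 = {F | ¬ P(F)}` is projection-closed, so the
sandwich «`P(per)` ∧ (`P` fails on all of `VP` under collapse)» always has a bare second piece.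

CONTENTS.
* §1 transport: a projection of `f` is a projection of any renaming of `f` along an equivalence; hence
  the BUNDLED permanent family `(perFamily k).poly` is `VNP`-complete in characteristic `≠ 2`
  (`isVNPComplete_perFamily`, from the tree's Valiant theorem `isVNPComplete_perPoly_holds`).
* §2 `IsProjClosed`; instances `VP`, `VNP`, intersections.
* §3 the criterion over any commutative semiring and any complete bundled `P`:
  `residual_of_collapseTo`, `collapseTo_of_residual`, `collapseTo_iff_residual`,
  `collapseTo_iff_collapseMem`, necessity `not_mem_of_VP_ne_VNP`, the node `VP_ne_VNP_iff_split`,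
  the degenerate top of the dial `not_mem_VP_iff` (`𝒞 = VP`: the lower-bound piece IS the summit) and
  monotonicity of both pieces in `𝒞`.
* §4 the summit over `ℂ` with `P = PER`: `summit_iff_split`, `collapseTo_iff_perResidual`.
* §5 the instance `𝒞 = VP_ws` in the form of Grochow–Kumar–Saks–Saraf (`GKSS2017.VPws`, p-families of
  p-bounded determinantal complexity): projection-closed (`isProjClosed_VPws`), contained in `VP_ℂ`
  (`VPws_subset_VP`), hence `VH ↔ PER ∉ VP_ws ∧ (VP = VNP → VP ⊆ VP_ws)` with the second piece bare
  (`summit_iff_split_VPws`, `collapseToVPws_iff_residual`).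

References: [cite: Burgisser2000, §2.1, Def. 2.6, Thm. 2.10, Rem. 2.11];
[cite: BurgisserClausenShokrollahi1997, Rem. (21.13)(2), Thm. (21.17)];
[cite: Vonzurgathen1987Feasible, Prop. 4.8]; [cite: GrochowKumarSaksSaraf2017, §2];
[cite: ForbesShpilkaVolk2018, §1] (succinct hitting sets / algebraically natural proofs: the measure-based
properties are projection-hereditary).
-/

-- layout Summits/ValiantsHypothesis/ValiantsHypothesis forces the duplicated namespace component
set_option linter.dupNamespace false

namespace Summit.ValiantsHypothesis.ValiantsHypothesis.Theorems.BareResidual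

open MvPolynomial Literature.Computability.AlgebraicComplexity

universe u

/-! ## §1 Transport along renamings; the bundled permanent family is `VNP`-complete -/

section Transport

variable {k : Type*} [CommSemiring k]

/-- A projection of `f` is a projection of `rename e f` for an equivalence `e` of variable types
(precompose the substitution with `e.symm`; Bürgisser 2000, Rem. 2.2: the classes do not depend on the
naming of variables). [cite: Burgisser2000, Rem. 2.2] -/
theorem isProjection_rename_right {σ σ' τ : Type*} (e : σ ≃ σ') {g : MvPolynomial τ k}
    {f : MvPolynomial σ k} (h : IsProjection g f) : IsProjection g (rename e f) := by
  obtain ⟨a, ha, hg⟩ := h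
  refine ⟨a ∘ e.symm, fun i => ha (e.symm i), ?_⟩
  rw [MvPolynomial.aeval_rename]
  have hcomp : (a ∘ ⇑e.symm) ∘ ⇑e = a := by
    funext i
    simp
  rw [hcomp]
  exact hg

/-- A p-projection of a family `f` is a p-projection of the family renamed levelwise along
equivalences (same `t`; Bürgisser 2000, Rem. 2.2). [cite: Burgisser2000, Rem. 2.2] -/
theorem isPProjection_renameEquiv_right {σ σ' τ : ℕ → Type*} (e : ∀ n, σ n ≃ σ' n)
    {g : ∀ n, MvPolynomial (τ n) k} {f : ∀ n, MvPolynomial (σ n) k} (h : IsPProjection g f) :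
    IsPProjection g (fun n => renameEquiv k (e n) (f n)) := by
  obtain ⟨t, ht, hproj⟩ := h
  refine ⟨t, ht, fun n => ?_⟩
  simp only [MvPolynomial.renameEquiv_apply]
  exact isProjection_rename_right (e (t n)) (hproj n)

end Transport

/-- **The bundled permanent family is `VNP`-complete** over a field of characteristic `≠ 2`: the tree's
Valiant theorem `isVNPComplete_perPoly_holds` for `n ↦ PER_n ∈ k[x_ij]`, transported along the bundling
equivalences `Fintype.equivFin (Fin n × Fin n)` of `PolyFamily.ofFintype` (Bürgisser 2000, Thm. 2.10 and
Rem. 2.2). [cite: Burgisser2000, Thm. 2.10] [cite: BurgisserClausenShokrollahi1997, Thm. (21.17)] -/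
theorem isVNPComplete_perFamily {k : Type u} [Field k] (hk : ringChar k ≠ 2) :
    IsVNPComplete (perFamily k).poly := by
  refine ⟨perFamily_mem_VNP_holds k, fun v g hg => ?_⟩
  exact isPProjection_renameEquiv_right (fun n => Fintype.equivFin (Fin n × Fin n))
    ((isVNPComplete_perPoly_holds k hk).2 v g hg)

/-! ## §2 Classes closed under p-projections -/

section Criterion

variable {k : Type u} [CommSemiring k]

/-- A class `𝒞` of bundled families is *closed downward under p-projections among p-families*: if
`F ∈ 𝒞` and the p-family `G` is a p-projection of `F` then `G ∈ 𝒞` (the closure property of `VP` and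
`VNP`, Bürgisser 2000, §2.1; BCS 1997, Rem. (21.13)(2); shared by `VP_ws`, `VF`, bounded-depth classes
and by every class cut out by a projection-hereditary complexity measure). [cite: Burgisser2000, §2.1] -/
def IsProjClosed (𝒞 : Set (PolyFamily k)) : Prop :=
  ∀ ⦃F G : PolyFamily k⦄, F ∈ 𝒞 → IsPFamily G.poly → IsPProjection G.poly F.poly → G ∈ 𝒞

/-- `VP` is closed under p-projections among p-families (`IsVPFamily.of_isPProjection_holds`;
Bürgisser 2000, §2.1). [cite: Burgisser2000, §2.1] -/
theorem isProjClosed_VP : IsProjClosed (VP k) :=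
  fun _ _ hF hG hGF => IsVPFamily.of_isPProjection_holds hG hGF hF

/-- `VNP` is closed under p-projections among p-families (`IsVNPFamily.of_isPProjection_holds`;
Bürgisser 2000, §2.1). [cite: Burgisser2000, §2.1] -/
theorem isProjClosed_VNP : IsProjClosed (VNP k) :=
  fun _ _ hF hG hGF => IsVNPFamily.of_isPProjection_holds hG hGF hF

/-- Intersections of projection-closed classes are projection-closed. [folklore] -/
theorem IsProjClosed.inter {𝒞 𝒟 : Set (PolyFamily k)} (h𝒞 : IsProjClosed 𝒞) (h𝒟 : IsProjClosed 𝒟) :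
    IsProjClosed (𝒞 ∩ 𝒟) :=
  fun _ _ hF hG hGF => ⟨h𝒞 hF.1 hG hGF, h𝒟 hF.2 hG hGF⟩

/-! ## §3 The criterion -/

variable {𝒞 𝒟 : Set (PolyFamily k)} {P : PolyFamily k}

/-- If a `VNP`-complete family lies in a projection-closed class then all of `VNP` does (every
`VNP` family is a p-family and a p-projection of the complete one; BCS 1997, p. 547 / Def. (21.14)).
[cite: BurgisserClausenShokrollahi1997, Def. (21.14)] -/
theorem vnp_subset_of_complete_mem (h𝒞 : IsProjClosed 𝒞) (hP : IsVNPComplete P.poly) (hP𝒞 : P ∈ 𝒞) :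
    VNP k ⊆ 𝒞 :=
  fun G hG => h𝒞 hP𝒞 (show IsVNPFamily G.poly from hG).1 (hP.2 G.nvars G.poly hG)

/-- **`B_𝒞 → (A_𝒞 → S)`, no hypothesis on the class**: the collapse piece always implies the residual of
the lower-bound piece (`P ∈ VNP = VP ⊆ 𝒞` contradicts `P ∉ 𝒞`). [folklore] -/
theorem residual_of_collapseTo (hPVNP : P ∈ VNP k) (hB : VP k = VNP k → VP k ⊆ 𝒞) :
    P ∉ 𝒞 → VP k ≠ VNP k := by
  intro hA hEq
  have hPVP : P ∈ VP k := by rw [hEq]; exact hPVNP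
  exact hA (hB hEq hPVP)

/-- **`(A_𝒞 → S) → B_𝒞` for a projection-closed class and a complete `P`**: under `VP = VNP` the
residual forces `P ∈ 𝒞`, and then `VP = VNP ⊆ 𝒞` by `vnp_subset_of_complete_mem`.
[cite: Burgisser2000, §2.1] -/
theorem collapseTo_of_residual (h𝒞 : IsProjClosed 𝒞) (hP : IsVNPComplete P.poly)
    (h : P ∉ 𝒞 → VP k ≠ VNP k) : VP k = VNP k → VP k ⊆ 𝒞 := by
  intro hEq
  have hP𝒞 : P ∈ 𝒞 := by
    by_contra hno
    exact h hno hEq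
  rw [hEq]
  exact vnp_subset_of_complete_mem h𝒞 hP hP𝒞

/-- **THE BARE-RESIDUAL CRITERION.** For a class `𝒞` closed under p-projections among p-families and a
`VNP`-complete bundled family `P`, the collapse piece `VP = VNP → VP ⊆ 𝒞` is EQUIVALENT to the residual
`P ∉ 𝒞 → VP ≠ VNP` of the lower-bound piece: it is bare. [cite: Burgisser2000, §2.1, Thm. 2.10] -/
theorem collapseTo_iff_residual (h𝒞 : IsProjClosed 𝒞) (hP : IsVNPComplete P.poly) :
    (VP k = VNP k → VP k ⊆ 𝒞) ↔ (P ∉ 𝒞 → VP k ≠ VNP k) :=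
  ⟨residual_of_collapseTo hP.1, collapseTo_of_residual h𝒞 hP⟩

/-- Class form versus single-family form of the collapse piece: for projection-closed `𝒞` and complete
`P`, `(VP = VNP → VP ⊆ 𝒞) ↔ (VP = VNP → P ∈ 𝒞)`. [cite: Burgisser2000, §2.1] -/
theorem collapseTo_iff_collapseMem (h𝒞 : IsProjClosed 𝒞) (hP : IsVNPComplete P.poly) :
    (VP k = VNP k → VP k ⊆ 𝒞) ↔ (VP k = VNP k → P ∈ 𝒞) := by
  constructor
  · intro hB hEq
    have hPVP : P ∈ VP k := by rw [hEq]; exact hP.1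
    exact hB hEq hPVP
  · intro h hEq
    rw [hEq]
    exact vnp_subset_of_complete_mem h𝒞 hP (h hEq)

/-- **Necessity of the lower-bound piece**: if `𝒞 ⊆ VP` then `VP ≠ VNP → P ∉ 𝒞` (a complete family in
`VP` collapses the classes: von zur Gathen 1987, Prop. 4.8; BCS 1997, Rem. (21.13)(2)).
[cite: Vonzurgathen1987Feasible, Prop. 4.8] -/
theorem not_mem_of_VP_ne_VNP (h𝒞VP : 𝒞 ⊆ VP k) (hP : IsVNPComplete P.poly) (hS : VP k ≠ VNP k) :
    P ∉ 𝒞 := by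
  intro hP𝒞
  refine hS (Set.Subset.antisymm (VP_subset_VNP_holds k) fun G hG => ?_)
  exact IsVPFamily.of_isPProjection_holds (show IsVNPFamily G.poly from hG).1
    (hP.2 G.nvars G.poly hG) (h𝒞VP hP𝒞)

/-- **The restricted-model AND-node**: for `𝒞 ⊆ VP` and complete `P`,
`VP ≠ VNP ↔ (P ∉ 𝒞) ∧ (VP = VNP → VP ⊆ 𝒞)` — both pieces necessary, jointly sufficient; by
`collapseTo_iff_residual` the second piece is bare as soon as `𝒞` is projection-closed.
[cite: Vonzurgathen1987Feasible, Prop. 4.8] -/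
theorem VP_ne_VNP_iff_split (h𝒞VP : 𝒞 ⊆ VP k) (hP : IsVNPComplete P.poly) :
    VP k ≠ VNP k ↔ P ∉ 𝒞 ∧ (VP k = VNP k → VP k ⊆ 𝒞) :=
  ⟨fun hS => ⟨not_mem_of_VP_ne_VNP h𝒞VP hP hS, fun hEq => absurd hEq hS⟩,
    fun h => residual_of_collapseTo hP.1 h.2 h.1⟩

/-- **Degenerate top of the dial** (`𝒞 = VP`): the lower-bound piece alone is the summit,
`P ∉ VP ↔ VP ≠ VNP` (von zur Gathen 1987, Prop. 4.8; the tree's `VPNeVNPComplex_iff_perFamily_not_mem_VP`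
is the instance `P = PER`, `k = ℂ`). [cite: Vonzurgathen1987Feasible, Prop. 4.8] -/
theorem not_mem_VP_iff (hP : IsVNPComplete P.poly) : P ∉ VP k ↔ VP k ≠ VNP k :=
  ⟨residual_of_collapseTo hP.1 fun _ => subset_rfl,
    fun hS => not_mem_of_VP_ne_VNP subset_rfl hP hS⟩

/-- The lower-bound piece is antitone in the class: `𝒞 ⊆ 𝒟 → (P ∉ 𝒟 → P ∉ 𝒞)`. [folklore] -/
theorem not_mem_anti (h : 𝒞 ⊆ 𝒟) : P ∉ 𝒟 → P ∉ 𝒞 :=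
  fun hA hP => hA (h hP)

/-- The collapse piece is monotone in the class: `𝒞 ⊆ 𝒟 → (B_𝒞 → B_𝒟)`. [folklore] -/
theorem collapseTo_mono (h : 𝒞 ⊆ 𝒟) :
    (VP k = VNP k → VP k ⊆ 𝒞) → (VP k = VNP k → VP k ⊆ 𝒟) :=
  fun hB hEq => (hB hEq).trans h

end Criterion

/-! ## §4 The summit over `ℂ`, `P = PER` -/

section Summit

variable {𝒞 : Set (PolyFamily ℂ)}

/-- The bundled permanent family over `ℂ` is `VNP`-complete (`ringChar ℂ = 0 ≠ 2`).
[cite: Burgisser2000, Thm. 2.10] -/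
theorem isVNPComplete_perFamily_complex : IsVNPComplete (perFamily ℂ).poly :=
  isVNPComplete_perFamily ringChar_complex_ne_two

/-- **Summit form of the node**: for every class `𝒞 ⊆ VP_ℂ`,
`ValiantsHypothesis ↔ PER ∉ 𝒞 ∧ (VP_ℂ = VNP_ℂ → VP_ℂ ⊆ 𝒞)`. [cite: Vonzurgathen1987Feasible, Prop. 4.8] -/
theorem summit_iff_split (h𝒞VP : 𝒞 ⊆ VP ℂ) :
    _root_.ValiantsHypothesis ↔ perFamily ℂ ∉ 𝒞 ∧ (VP ℂ = VNP ℂ → VP ℂ ⊆ 𝒞) :=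
  VP_ne_VNP_iff_split h𝒞VP isVNPComplete_perFamily_complex

/-- Necessity of the restricted-model lower bound for the permanent: `VH → PER ∉ 𝒞` for `𝒞 ⊆ VP_ℂ`.
[cite: Vonzurgathen1987Feasible, Prop. 4.8] -/
theorem per_not_mem_of_summit (h𝒞VP : 𝒞 ⊆ VP ℂ) (h : _root_.ValiantsHypothesis) : perFamily ℂ ∉ 𝒞 :=
  not_mem_of_VP_ne_VNP h𝒞VP isVNPComplete_perFamily_complex h

/-- **Summit form of the criterion**: for every class `𝒞` closed under p-projections among p-families,
`(VP_ℂ = VNP_ℂ → VP_ℂ ⊆ 𝒞) ↔ (PER ∉ 𝒞 → ValiantsHypothesis)` — the collapse piece is the bare residual.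
[cite: Burgisser2000, §2.1, Thm. 2.10] -/
theorem collapseTo_iff_perResidual (h𝒞 : IsProjClosed 𝒞) :
    (VP ℂ = VNP ℂ → VP ℂ ⊆ 𝒞) ↔ (perFamily ℂ ∉ 𝒞 → _root_.ValiantsHypothesis) :=
  collapseTo_iff_residual h𝒞 isVNPComplete_perFamily_complex

end Summit

/-! ## §5 The instance `𝒞 = VP_ws` (Grochow–Kumar–Saks–Saraf's determinantal form) -/

section VPws

open Literature.Barriers.ValiantsHypothesis.GKSS2017

/-- **`VP_ws` is closed under p-projections among p-families**: a projection of a determinant of affine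
forms is a determinant of affine forms of the same size (`HasDetRepr.of_isProjection_holds`), and
`t ∘ s` is p-bounded (GKSS 2017, §2; Bürgisser 2000, §2.5). [cite: GrochowKumarSaksSaraf2017, §2] -/
theorem isProjClosed_VPws {k : Type*} [CommRing k] : IsProjClosed (VPws k) := by
  rintro F G ⟨-, t, ht, hdet⟩ hG ⟨s, hs, hproj⟩
  exact ⟨hG, fun n => t (s n), IsPBounded.comp_holds ht hs,
    fun n => HasDetRepr.of_isProjection_holds (hdet (s n)) (hproj n)⟩

/-- **`VP_ws ⊆ VP` over `ℂ`**: a determinant of `t(n) × t(n)` affine forms in `v(n)` variables has a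
circuit of size `≤ 8 (t(n)+1)⁷ + t(n)² (2 v(n) + 2)` (Berkowitz; tree `complexity_le_of_hasDetRepr`),
p-bounded when `t` and `v` are (Bürgisser 2000, Prop. 2.30 / §2.5). [cite: Burgisser2000, §2.5] -/
theorem VPws_subset_VP : VPws ℂ ⊆ VP ℂ := by
  rintro F ⟨hF, t, ht, hdet⟩
  refine ⟨hF, ?_⟩
  have hb : IsPBounded fun n => 8 * (t n + 1) ^ 7 + t n ^ 2 * (2 * Fintype.card (Fin (F.nvars n)) + 2) :=
    IsPBounded.add_holds
      (IsPBounded.mul_holds (IsPBounded.const 8)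
        (IsPBounded.pow_holds (IsPBounded.add_holds ht (IsPBounded.const 1)) 7))
      (IsPBounded.mul_holds (IsPBounded.pow_holds ht 2)
        (IsPBounded.add_holds (IsPBounded.mul_holds (IsPBounded.const 2) hF.1) (IsPBounded.const 2)))
  show IsPBounded fun n => complexity (F.poly n)
  exact hb.mono fun n => complexity_le_of_hasDetRepr (hdet n)

/-- **The `VP_ws` node and its bare residual**: `ValiantsHypothesis ↔ PER ∉ VP_ws ∧ (VP = VNP → VP ⊆ VP_ws)`.
[cite: GrochowKumarSaksSaraf2017, §2] [cite: Vonzurgathen1987Feasible, Prop. 4.8] -/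
theorem summit_iff_split_VPws :
    _root_.ValiantsHypothesis ↔ perFamily ℂ ∉ VPws ℂ ∧ (VP ℂ = VNP ℂ → VP ℂ ⊆ VPws ℂ) :=
  summit_iff_split VPws_subset_VP

/-- … in which the collapse piece «`VP = VNP → VP = VBP`» is exactly the residual
`PER ∉ VP_ws → ValiantsHypothesis`. [cite: GrochowKumarSaksSaraf2017, §2] [cite: Burgisser2000, Thm. 2.10] -/
theorem collapseToVPws_iff_residual :
    (VP ℂ = VNP ℂ → VP ℂ ⊆ VPws ℂ) ↔ (perFamily ℂ ∉ VPws ℂ → _root_.ValiantsHypothesis) :=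
  collapseTo_iff_perResidual isProjClosed_VPws

end VPws

end Summit.ValiantsHypothesis.ValiantsHypothesis.Theorems.BareResidual
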